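import Literature.Analysis.FluidPDE.TaoLocalisation
import Literature.Analysis.FluidPDE.MildSolution
import HarnessLib

/-!
# Tao (2011/2013), *Localisation and compactness properties of the Navier–Stokes global
# regularity problem* — Cor. 4.3 and Thm. 5.4 (iv) as separate named facts
# (family `ns`, topic `Literature/Analysis/FluidPDE`)

Second layer, `B`-side, of the decomposition of `NS.tao2011_hasBoundedSobolevNormsOn`
(`TaoLocalisation.lean`): the named fact `NS.tao2011_hasBoundedSobolevNormsOn_of_memSobolevX`
(Tao2011, Cor. 4.3 + Thm. 5.4 (iv)) is **proved** here
(`NS.tao2011_hasBoundedSobolevNormsOn_of_memSobolevX_of_parts`) from its two printed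
ingredients, vendored separately (D-0014: `def … : Prop`, no `sorry`):

* `NS.tao2011_isMildNSSolutionOn_of_memSobolevX` — **Cor. 4.3** (arXiv Cor. 27, p. 15: *almost
  smooth `H¹` solutions are essentially mild*), in the tested (duality) form of the Duhamel
  formula carried by the accepted `Fluid.IsMildNSSolutionOn` (Fabes–Jones–Rivière 1972, Thm. 2.1).
* `NS.tao2011_hasBoundedSobolevNormsOn_of_isMildNSSolutionOn` — **Thm. 5.4 (iv)** with the note
  closing its proof (arXiv Thm. 31 (iv), p. 18: *regularity of `H¹` mild solutions*), for
  velocities that are classical on the closed slab.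

## Design (junk-value hazard, recorded)

Tao's `H¹` mild solutions (arXiv p. 6: `u₀ ∈ H¹_x`, `u ∈ X¹ = L^∞_t H¹_x ∩ L²_t H²_x`, `p` given
by (pressure-point) `p = -Δ⁻¹∂ᵢ∂ⱼ(uᵢuⱼ)`, divergence free, Duhamel formula (12)) are in general
not smooth, whereas the accepted classes `NS.MemSobolevX` / `NS.HasBoundedSobolevNormsOn` measure
`iteratedFDeriv ℝ n (u t)` and are meaningful only for smooth slices (junk `0` elsewhere).
Thm. 5.4 (iv) is therefore **not** vendored for general mild solutions in these terms (its
hypotheses would be junk-trivial); both facts keep the hypothesis that `(u, p)` is a classical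
solution on the closed slab `[0, T] × ℝ³`, the only case used by
`NS.tao2011_hasBoundedSobolevNormsOn`, and a subclass of Tao's hypotheses in each case.

## Dictionary

* Tao's Duhamel formula (12)/(13), `u(t) = e^{tΔ}u₀ + ∫₀ᵗ e^{(t-t')Δ}(P B(u,u) + P f)(t') dt'`,
  paired with a smooth compactly supported divergence-free `φ` (so that `P` drops out and
  `⟨B(u,u), ψ⟩ = ∫ uᵢuⱼ∂ⱼψᵢ = ∫ ⟪u, (u·∇)ψ⟫` for divergence-free `u`), is exactly the tested
  identity `Fluid.IsMildNSSolutionFrom ν 0 (u 0) u t` (`heatTest ν φ τ = e^{ντΔ}φ`); together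
  with weak divergence-freeness this is `Fluid.IsMildNSSolutionOn (Icc 0 T) ν 0 (u 0) u`.
  Conversely, for `u ∈ X¹` the tested identity for all such `φ` gives (13) (both sides are
  divergence-free `L²` fields agreeing modulo gradients), hence (12) with the normalised
  pressure — so for a classical `u ∈ X¹([0,T] × ℝ³)` "`(u, p̃, u(0), 0, T)` is an `H¹` mild
  solution" and "`IsMildNSSolutionOn (Icc 0 T) ν 0 (u 0) u`" say the same thing
  (Fabes–Jones–Rivière 1972, Thm. 2.1, equivalence of the integral and the tested forms).
* `ν = 1` in print; `ν > 0` by the rescaling of footnote 3 (`v(s,x) = ν⁻¹u(s/ν,x)`), which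
  preserves every class involved.

## References

* T. Tao, arXiv:1108.1165 = Anal. PDE 6 (2013) (`Tao2011`): §1 pp. 3, 5–6 ((6), (7), (12)–(14),
  `H¹` mild solutions), Lemma 4.1 and Cor. 4.3 (arXiv Lemma 25, Cor. 27; pp. 14–15), Thm. 5.4
  (arXiv Thm. 31, p. 18) and the note closing its proof. The secondary locators "arXiv Lemma 25,
  Cor. 27, Thm. 31" and their pages refer to the sequential numbering and pagination of the held
  arXiv source text (51 pp., `lit read arxiv:1108.1165`), not to the journal numbering
  (Lemma 4.1, Cor. 4.3, Thm. 5.4) used in the `[cite]` tags.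
* E. B. Fabes, B. F. Jones, N. M. Rivière, *The initial value problem for the Navier–Stokes
  equations with data in `Lᵖ`*, ARMA 45 (1972), Thm. 2.1 (`FabesJonesRiviere1972`).
-/

noncomputable section

open MeasureTheory Set Function Filter Topology
open scoped ENNReal NNReal InnerProductSpace RealInnerProductSpace ContDiff

namespace Literature.Analysis.FluidPDE

/-- Local notation for physical space `ℝ³ = EuclideanSpace ℝ (Fin 3)`. -/
local notation "ℝ³" => EuclideanSpace ℝ (Fin 3)

/-- **Tao 2011, Cor. 4.3 (Almost smooth `H¹` solutions are essentially mild)** (arXiv Cor. 27,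
p. 15), homogeneous case, tested form. Printed: "Let `(u, p, u₀, f, T)` be an almost smooth `H¹`
solution. Then `(u, p̃, u₀, f, T)` is a mild `H¹` solution, where
`p̃ := -Δ⁻¹∂ᵢ∂ⱼ(uᵢuⱼ) + Δ⁻¹∇·f`. Furthermore, for almost every `t ∈ [0, T]`, `p(t)` and `p̃(t)`
differ by a constant." Vendored for `f = 0`, `ν > 0` (footnote-3 rescaling) and classical
solutions on the **closed** slab `[0, T] × ℝ³` (`Fluid.IsClassicalNSSolutionOn (Icc 0 T)`, a
subclass of almost smooth): if such a solution is an *`H¹` solution* ((7), p. 3: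
`u ∈ L^∞_t H¹_x ∩ L²_t H²_x`, i.e. `MemSobolevX 1 T u`, which contains the finite-energy
condition (6) and puts the datum `u(0)` in `H¹`), then `u` satisfies the Duhamel formula (13)
from its datum `u(0)` in the tested form against smooth compactly supported divergence-free
fields — `Fluid.IsMildNSSolutionOn (Icc 0 T) ν 0 (u 0) u` (pairing (13) with such a `φ`; see the
module docstring) — which is the velocity content of "`(u, p̃)` is a mild `H¹` solution" (the
pressure content, `p̃ = normalisedPressure ∘ u` up to a constant for a.e. `t`, is the accepted
`NS.tao_pressure_normalisation`, Lemma 4.1 (i)). Not a duplicate of the nearest tree fact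
`Fluid.IsClassicalNSSolutionOn.isMildNSSolutionOn` (`MildSolution.lean`: classical + `u`, `p`, `f`
*bounded* on `[0, T] × ℝ³` ⇒ the same conclusion): an `X¹` classical solution need not be bounded
in `x`, and no bound on `p` is available in the Cor. 11.1 chain, so neither fact implies the
other. [cite: Tao2011, Cor. 4.3] -/
def tao2011_isMildNSSolutionOn_of_memSobolevX : Prop :=
  ∀ ⦃ν T : ℝ⦄ (_hν : 0 < ν) (_hT : 0 < T) ⦃u : ℝ → ℝ³ → ℝ³⦄ ⦃p : ℝ → ℝ³ → ℝ⦄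
    (_hsol : FluidPDE.IsClassicalNSSolutionOn (Icc 0 T) ν 0 u p) (_hX : MemSobolevX 1 T u),
    FluidPDE.IsMildNSSolutionOn (Icc 0 T) ν 0 (u 0) u

/-- **Tao 2011, Thm. 5.4 (iv) (Regularity of `H¹` mild solutions) with the note closing its
proof** (arXiv Thm. 31 (iv), p. 18). Printed: "If `(u, p, u₀, f, T, 1)` is a `H¹` mild solution,
and `(u₀, f, T)` is Schwartz, then `u` and `p` are smooth; in fact, one has
`∂ₜʲu, ∂ₜʲp ∈ L^∞_t H^k([0, T] × ℝ³)` for all `j, k ≥ 0`"; note (p. 18): "these arguments did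
not require the full power of the hypothesis that `(u₀, f, T)` was Schwartz; it would have
sufficed to have `u₀ ∈ H^k_x(ℝ³)` and `f ∈ C^j_t H^k_x(ℝ³)` for all `j, k ≥ 0`." Vendored for
`f = 0`, `ν > 0` (footnote-3 rescaling), conclusion `j = 0`, and — because the accepted Sobolev
classes measure classical derivatives of the slices (module docstring) — for velocities that are
classical solutions on the closed slab `[0, T] × ℝ³`: if such a `u` lies in `X¹([0,T] × ℝ³)`
(`MemSobolevX 1 T u`), satisfies the Duhamel formula from its datum in tested form
(`Fluid.IsMildNSSolutionOn (Icc 0 T) ν 0 (u 0) u`; for `u ∈ X¹` this makes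
`(u, p̃, u(0), 0, T)` an `H¹` mild solution in Tao's sense, `p̃` the normalised pressure), and
`u(0) ∈ H^k_x` for every `k`, then `u ∈ L^∞_t H^k_x([0, T] × ℝ³)` for every `k`, i.e.
`HasBoundedSobolevNormsOn (Icc 0 T) u` (pointwise sup in `t`, equal to the essential sup for the
jointly smooth `u`). [cite: Tao2011, Thm. 5.4 (iv)] -/
def tao2011_hasBoundedSobolevNormsOn_of_isMildNSSolutionOn : Prop :=
  ∀ ⦃ν T : ℝ⦄ (_hν : 0 < ν) (_hT : 0 < T) ⦃u : ℝ → ℝ³ → ℝ³⦄ ⦃p : ℝ → ℝ³ → ℝ⦄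
    (_hsol : FluidPDE.IsClassicalNSSolutionOn (Icc 0 T) ν 0 u p) (_hX : MemSobolevX 1 T u)
    (_hmild : FluidPDE.IsMildNSSolutionOn (Icc 0 T) ν 0 (u 0) u)
    (_h₀ : ∀ n : ℕ, ∫⁻ x, ‖iteratedFDeriv ℝ n (u 0) x‖ₑ ^ 2 < ⊤),
    HasBoundedSobolevNormsOn (Icc 0 T) u

/-- **Assembly (proved): Cor. 4.3 + Thm. 5.4 (iv) ⇒ `tao2011_hasBoundedSobolevNormsOn_of_memSobolevX`.**
A classical `H¹` solution on the closed slab is mild from its datum (Cor. 4.3), and mild `H¹`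
solutions with `H^∞` datum have all Sobolev norms bounded (Thm. 5.4 (iv) + note) — the chain
recorded in the docstring of `tao2011_hasBoundedSobolevNormsOn_of_memSobolevX`. [cite: Tao2011, Cor. 4.3 + Thm. 5.4 (iv)] -/
theorem tao2011_hasBoundedSobolevNormsOn_of_memSobolevX_of_parts
    (hB₁ : tao2011_isMildNSSolutionOn_of_memSobolevX)
    (hB₂ : tao2011_hasBoundedSobolevNormsOn_of_isMildNSSolutionOn) :
    tao2011_hasBoundedSobolevNormsOn_of_memSobolevX :=
  fun _ν _T hν hT _u _p hsol hX h₀ => hB₂ hν hT hsol hX (hB₁ hν hT hsol hX) h₀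

/-- **`NS.tao2011_hasBoundedSobolevNormsOn` from the four second-layer facts of the `A`- and
`B`-sides is then `tao2011_hasBoundedSobolevNormsOn_of_parts hA (…of_memSobolevX_of_parts hB₁ hB₂)`**;
recorded here for the `B`-side alone: bounded enstrophy (Cor. 11.1) and the two facts above give
the composite fact. [cite: Tao2011, Cor. 11.1 + Cor. 4.3 + Thm. 5.4 (iv)] -/
theorem tao2011_hasBoundedSobolevNormsOn_of_boundedEnstrophy_of_parts (hA : tao2011_boundedEnstrophy)
    (hB₁ : tao2011_isMildNSSolutionOn_of_memSobolevX)
    (hB₂ : tao2011_hasBoundedSobolevNormsOn_of_isMildNSSolutionOn) :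
    tao2011_hasBoundedSobolevNormsOn :=
  tao2011_hasBoundedSobolevNormsOn_of_parts hA
    (tao2011_hasBoundedSobolevNormsOn_of_memSobolevX_of_parts hB₁ hB₂)

end Literature.Analysis.FluidPDE

end
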